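import Summits.ABC.ABC.Theorems.DefiniteXiDefiniteRTControlPrimeCyclicCharacterLocal
import HarnessLib

/-!
# Crux `DefiniteRTControlPrime` from Takahashi 2.3 alone — part 2/7: the character AT `ℓ` (containers)

Local analysis of the cyclic-isogeny character `r` at a place `𝔓 ∣ ℓ` where `W` is semistable: the ordinary
and multiplicative filtrations of `W[ℓᵏ]` over the completion (`exists_ordinaryFiltration_adicCompletionPrime`,
`exists_multiplicativeFiltration_adicCompletionPrime`), the two-clause CONTAINER for the inertia group
(`container_of_local`), the filtration dichotomy and the supersingular exclusion
(`not_dvd_frobeniusTrace_of_isogenyCharacter`).  Continues `DefiniteXiDefiniteRTControlPrimeCyclicCharacterLocal`.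

Origin: crux programme of stmt-ABC-11338, kernel certificate `Cruxes/DefiniteRTControlPrime/StubIdeasK2G11CruxFromTakahashi.lean` (stub-ideation k2, gens 2–11; farm `lean check` rc 0, 0 sorries, axioms propext/Classical.choice/Quot.sound), re-packaged verbatim into seven `≤ 400`-line modules by k2 gen 12 (namespaces `…Theorems.DefiniteRTControlPrime.CyclicCharacter` / `.OfTakahashi`; statements and proofs unchanged).

## References

* [Mazur1978] B. Mazur, Rational isogenies of prime degree, Invent. Math. 44 (1978) 129–162, §5 (isogeny characters), Lemma 5.2–5.4.
* [Serre1972] J.-P. Serre, Propriétés galoisiennes des points d'ordre fini des courbes elliptiques, Invent. Math. 15 (1972), §1.11–1.12, §5.4 Prop. 21.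
* [SilvermanATAEC1994] J. H. Silverman, Advanced Topics in the Arithmetic of Elliptic Curves, GTM 151, Thm. V.5.3, Cor. V.5.4, Prop. V.6.1 (Tate curve, Galois action).
* [Takahashi2001] S. Takahashi, Degrees of parametrizations of elliptic curves by Shimura curves, J. Number Theory 90 (2001) 74–88, Thm. 2.3 (p. 79).
* [PastenShimura2024] H. Pasten, Shimura curves and the abc conjecture, J. Number Theory 254 (2024) 214–335 = arXiv:1705.09251, §3 p. 13, §6.4, Lemma 6.8.
-/

set_option linter.dupNamespace false

namespace Summit.ABC.ABC.Theorems.DefiniteRTControlPrime.CyclicCharacter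

open Literature.NumberTheory.EllipticCurves Literature.NumberTheory.EllipticCurves.ModularForms
open Literature.NumberTheory.GaloisRepresentations Literature.NumberTheory.EllipticCurves.TateCurve
open WeierstrassCurve IsDedekindDomain IsDedekindDomain.HeightOneSpectrum NumberField Field
open scoped NumberField NNReal Classical

/-! ## §5 LOCℓ ASSEMBLED (gen 11).  Inputs: D1 (g7, proved — copied), CONJ / D-TRANS / D2₀ (g10, proved —
copied), D3loc (§2, proved HERE), SS′ (= the `exfalso` branch of
`Mazur1978.modEq_zero_or_one_of_hasGoodReductionAtPrime`, extracted HERE), H2 (container ⇒ dichotomy). -/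

section LOCell

open Rat.HeightOneSpectrum

/-- CONJ (g10 verbatim, proved). -/
theorem eqOn_inertia_of_eqOn_inertia_one {K : Type*} [Field K] [NumberField K] {M : Type*}
    [CommGroup M] (ψ₁ ψ₂ : absoluteGaloisGroup K →* M) (v : HeightOneSpectrum (𝓞 K))
    {𝔓₀ : Ideal (absIntegers (𝓞 K) K)} (h𝔓₀ : 𝔓₀ ∈ v.primesAbove)
    (h : ∀ τ ∈ 𝔓₀.inertia (absoluteGaloisGroup K), ψ₁ τ = ψ₂ τ)
    {𝔓 : Ideal (absIntegers (𝓞 K) K)} (h𝔓 : 𝔓 ∈ v.primesAbove)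
    {τ : absoluteGaloisGroup K} (hτ : τ ∈ 𝔓.inertia (absoluteGaloisGroup K)) :
    ψ₁ τ = ψ₂ τ := by
  obtain ⟨g, rfl⟩ := HeightOneSpectrum.exists_smul_eq_of_mem_primesAbove_holds h𝔓₀ h𝔓
  rw [absIntegers.inertia_smul, Subgroup.mem_pointwise_smul_iff_inv_smul_mem] at hτ
  have key := h _ hτ
  simp only [MulAut.smul_def] at key
  simpa [map_mul, map_inv, mul_inv_cancel_comm, inv_mul_cancel_comm] using key

/-- D-TRANS (g10 verbatim, proved). -/
theorem container_of_local (W : WeierstrassCurve ℚ) [W.IsElliptic] (v : HeightOneSpectrum (𝓞 ℚ))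
    (m : ℕ) [NeZero m] [NeZero (m : v.adicCompletion ℚ)]
    (E₁loc : AddSubgroup (localPoints W (v.adicCompletion ℚ)))
    (h1 : ∀ σ ∈ absInertia (v.adicCompletion ℚ), ∀ Q ∈ E₁loc, m • Q = 0 →
      σ • Q = ((modNCyclotomicCharacter (v.adicCompletion ℚ) m σ : (ZMod m)ˣ) : ZMod m).val • Q)
    (h2 : ∀ σ ∈ absInertia (v.adicCompletion ℚ), ∀ Q : localPoints W (v.adicCompletion ℚ),
      m • Q = 0 → σ • Q - Q ∈ E₁loc) :
    (∀ τ ∈ (adicCompletionPrime ℚ v).inertia (absoluteGaloisGroup ℚ),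
        ∀ Q ∈ E₁loc.comap (pointsMapOfEmb W (closureEmb (v.adicCompletion ℚ))), m • Q = 0 →
        τ • Q = ((((modNCyclotomicCharacter ℚ m τ : (ZMod m)ˣ) : ZMod m).val : ℤ)) • Q) ∧
    (∀ τ ∈ (adicCompletionPrime ℚ v).inertia (absoluteGaloisGroup ℚ), ∀ Q : geomPoints W,
        m • Q = 0 → τ • Q - Q ∈ E₁loc.comap (pointsMapOfEmb W (closureEmb (v.adicCompletion ℚ)))) := by
  have hinj := pointsMapOfEmb_injective W (closureEmb (K := ℚ) (v.adicCompletion ℚ))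
  have hequiv : ∀ (σ : absoluteGaloisGroup (v.adicCompletion ℚ)) (P : geomPoints W),
      pointsMapOfEmb W (closureEmb (K := ℚ) (v.adicCompletion ℚ))
          (absGaloisRestrict ℚ (v.adicCompletion ℚ) σ • P) =
        σ • pointsMapOfEmb W (closureEmb (K := ℚ) (v.adicCompletion ℚ)) P := by
    intro σ P
    rw [← resGal_eq_absGaloisRestrict, resGal_eq, pointsMapOfEmb_smul]
  constructor
  · intro τ hτ Q hQ hQm
    rw [inertia_adicCompletionPrime_eq_map_absInertia ℚ v] at hτ
    obtain ⟨σ, hσ, rfl⟩ := Subgroup.mem_map.mp hτ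
    change absGaloisRestrict ℚ (v.adicCompletion ℚ) σ • Q =
      ((((modNCyclotomicCharacter ℚ m (absGaloisRestrict ℚ (v.adicCompletion ℚ) σ) :
        (ZMod m)ˣ) : ZMod m).val : ℤ)) • Q
    rw [modNCyclotomicCharacter_absGaloisRestrict, natCast_zsmul]
    apply hinj
    rw [hequiv, map_nsmul]
    refine h1 σ hσ _ (AddSubgroup.mem_comap.mp hQ) ?_
    rw [← map_nsmul, hQm, map_zero]
  · intro τ hτ Q hQm
    rw [inertia_adicCompletionPrime_eq_map_absInertia ℚ v] at hτ
    obtain ⟨σ, hσ, rfl⟩ := Subgroup.mem_map.mp hτ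
    change absGaloisRestrict ℚ (v.adicCompletion ℚ) σ • Q - Q ∈ _
    rw [AddSubgroup.mem_comap, map_sub, hequiv]
    refine h2 σ hσ _ ?_
    rw [← map_nsmul, hQm, map_zero]

/-- D2₀ (g10 verbatim, proved). -/
theorem exists_ordinaryFiltration_adicCompletionPrime (W : WeierstrassCurve ℚ) [W.IsElliptic]
    {v : HeightOneSpectrum (𝓞 ℚ)} (hgood : W.HasGoodReductionAt v) {ℓ : ℕ} [Fact ℓ.Prime]
    (hℓv : (ℓ : 𝓞 ℚ) ∈ v.asIdeal) (hord : ¬ ((ℓ : ℤ) ∣ W.frobeniusTraceAt v)) (k : ℕ) :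
    ∃ E₁ : AddSubgroup (geomPoints W),
      (∀ τ ∈ (adicCompletionPrime ℚ v).inertia (absoluteGaloisGroup ℚ), ∀ Q ∈ E₁, ℓ ^ k • Q = 0 →
        τ • Q = ((((modNCyclotomicCharacter ℚ (ℓ ^ k) τ : (ZMod (ℓ ^ k))ˣ) :
          ZMod (ℓ ^ k)).val : ℤ)) • Q) ∧
      (∀ τ ∈ (adicCompletionPrime ℚ v).inertia (absoluteGaloisGroup ℚ), ∀ Q : geomPoints W,
        ℓ ^ k • Q = 0 → τ • Q - Q ∈ E₁) := by
  haveI : NeZero ((ℓ : ℕ) : v.adicCompletion ℚ) :=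
    NeZero.nat_of_injective (algebraMap ℚ (v.adicCompletion ℚ)).injective
  haveI : NeZero ((ℓ ^ k : ℕ) : v.adicCompletion ℚ) :=
    NeZero.nat_of_injective (algebraMap ℚ (v.adicCompletion ℚ)).injective
  refine ⟨(W.localKernelOfReduction v).comap (pointsMapOfEmb W (closureEmb (v.adicCompletion ℚ))),
    ?_, ?_⟩
  · intro τ hτ Q hQ hQk
    rw [inertia_adicCompletionPrime_eq_map_absInertia ℚ v] at hτ
    obtain ⟨σ, hσ, rfl⟩ := Subgroup.mem_map.mp hτ
    change absGaloisRestrict ℚ (v.adicCompletion ℚ) σ • Q =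
      ((((modNCyclotomicCharacter ℚ (ℓ ^ k) (absGaloisRestrict ℚ (v.adicCompletion ℚ) σ) :
        (ZMod (ℓ ^ k))ˣ) : ZMod (ℓ ^ k)).val : ℤ)) • Q
    rw [modNCyclotomicCharacter_absGaloisRestrict, natCast_zsmul,
      modNCyclotomicCharacter_eq_toZModPow_cyclotomicCharacter]
    exact ordinaryReduction_inertia_smul_of_mem_kernelReduction_holds W ℓ v hℓv hgood hord σ hσ k Q
      hQk (AddSubgroup.mem_comap.mp hQ)
  · intro τ hτ Q hQk
    rw [inertia_adicCompletionPrime_eq_map_absInertia ℚ v] at hτ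
    obtain ⟨σ, hσ, rfl⟩ := Subgroup.mem_map.mp hτ
    obtain ⟨φ, hφI, -, hφ⟩ :=
      ordinaryReduction_exists_unramified_character_mod_kernelReduction_holds W ℓ v hℓv hgood hord
    have h := hφ σ k Q hQk
    rw [hφI σ hσ, Units.val_one, map_one] at h
    change absGaloisRestrict ℚ (v.adicCompletion ℚ) σ • Q - Q ∈ _
    rw [AddSubgroup.mem_comap]
    rcases Nat.eq_zero_or_pos k with rfl | hk
    · have hQ0 : Q = 0 := by simpa using hQk
      rw [hQ0, smul_zero, sub_zero, map_zero]
      exact AddSubgroup.zero_mem _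
    · haveI : Fact (1 < ℓ ^ k) := ⟨Nat.one_lt_pow hk.ne' (Fact.out : ℓ.Prime).one_lt⟩
      rwa [ZMod.val_one, one_smul] at h

/-- **D3′₀ (PROVED: D3loc of §2 + D-TRANS).**  The multiplicative container at `𝔓₀`. -/
theorem exists_multiplicativeFiltration_adicCompletionPrime (W : WeierstrassCurve ℚ) [W.IsElliptic]
    {v : HeightOneSpectrum (𝓞 ℚ)} (hv : W.HasMultiplicativeReductionAt v) {ℓ : ℕ} [Fact ℓ.Prime]
    (hℓv : (ℓ : 𝓞 ℚ) ∈ v.asIdeal) (k : ℕ) [NeZero ((ℓ ^ k : ℕ) : v.adicCompletion ℚ)] :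
    ∃ E₁ : AddSubgroup (geomPoints W),
      (∀ τ ∈ (adicCompletionPrime ℚ v).inertia (absoluteGaloisGroup ℚ), ∀ Q ∈ E₁, ℓ ^ k • Q = 0 →
        τ • Q = ((((modNCyclotomicCharacter ℚ (ℓ ^ k) τ : (ZMod (ℓ ^ k))ˣ) :
          ZMod (ℓ ^ k)).val : ℤ)) • Q) ∧
      (∀ τ ∈ (adicCompletionPrime ℚ v).inertia (absoluteGaloisGroup ℚ), ∀ Q : geomPoints W,
        ℓ ^ k • Q = 0 → τ • Q - Q ∈ E₁) := by
  haveI : NeZero (ℓ ^ k) := ⟨pow_ne_zero _ (Fact.out : ℓ.Prime).ne_zero⟩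
  obtain ⟨h1, h2⟩ := exists_multiplicativeContainer_local W hv hℓv k
  exact ⟨_, container_of_local W v (ℓ ^ k) (W.localKernelOfReduction v) h1 h2⟩

/-- D1 (g7 verbatim, proved): the Borel sandwich on one line. -/
theorem filtration_dichotomy {M : Type*} [AddCommGroup M] {ℓ k : ℕ} (hℓ : ℓ.Prime)
    (E₁ : AddSubgroup M) {ι : Type*} (τ : ι → M →+ M) (x y : ι → ℤ)
    (hx : ∀ i, ∀ Q ∈ E₁, ℓ ^ k • Q = 0 → τ i Q = x i • Q)
    (hy : ∀ i (Q : M), ℓ ^ k • Q = 0 → τ i Q - y i • Q ∈ E₁)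
    (i₀ : ι) (hi₀ : ¬ ((ℓ : ℤ) ∣ x i₀ - y i₀))
    {P : M} (hP : addOrderOf P = ℓ ^ k) (lam : ι → ℤ) (hlam : ∀ i, τ i P = lam i • P) :
    (∀ i, (ℓ : ℤ) ^ k ∣ lam i - y i) ∨ (∀ i, (ℓ : ℤ) ^ k ∣ lam i - x i) := by
  classical
  have hℓ0 : (ℓ : ℤ) ≠ 0 := by exact_mod_cast hℓ.ne_zero
  have hPk : ℓ ^ k • P = 0 := by rw [← hP]; exact addOrderOf_nsmul_eq_zero P
  have hPk' : ((ℓ ^ k : ℕ) : ℤ) • P = 0 := by rw [natCast_zsmul]; exact hPk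
  have hord : ∀ n : ℤ, n • P = 0 ↔ (ℓ : ℤ) ^ k ∣ n := fun n => by
    rw [← addOrderOf_dvd_iff_zsmul_eq_zero, hP, Int.natCast_pow]
  have hex : ∃ c : ℕ, ℓ ^ c • P ∈ E₁ := ⟨k, by rw [hPk]; exact E₁.zero_mem⟩
  obtain ⟨μ, hμmem, hμmin⟩ : ∃ μ : ℕ, ℓ ^ μ • P ∈ E₁ ∧ ∀ c : ℕ, ℓ ^ c • P ∈ E₁ → μ ≤ c :=
    ⟨Nat.find hex, Nat.find_spec hex, fun c hc => Nat.find_min' hex hc⟩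
  have hμk : μ ≤ k := hμmin k (by rw [hPk]; exact E₁.zero_mem)
  have hgen : ∀ n : ℤ, n • P ∈ E₁ → (ℓ : ℤ) ^ μ ∣ n := by
    intro n hn
    have hbez : ((Int.gcd n ((ℓ ^ k : ℕ) : ℤ) : ℕ) : ℤ) • P ∈ E₁ := by
      rw [Int.gcd_eq_gcd_ab n ((ℓ ^ k : ℕ) : ℤ), add_smul, mul_comm n, mul_smul,
        mul_comm ((ℓ ^ k : ℕ) : ℤ), mul_smul, hPk', smul_zero, add_zero]
      exact E₁.zsmul_mem hn _
    have hdvd : Int.gcd n ((ℓ ^ k : ℕ) : ℤ) ∣ ℓ ^ k :=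
      Int.natCast_dvd_natCast.mp (Int.gcd_dvd_right _ _)
    obtain ⟨c, -, hc⟩ := (Nat.dvd_prime_pow hℓ).mp hdvd
    have hμc : μ ≤ c := hμmin c (by rw [← hc, ← natCast_zsmul]; exact hbez)
    have hn' : ((Int.gcd n ((ℓ ^ k : ℕ) : ℤ) : ℕ) : ℤ) ∣ n := Int.gcd_dvd_left _ _
    rw [hc, Int.natCast_pow] at hn'
    exact (pow_dvd_pow _ hμc).trans hn'
  have hy' : ∀ i, (ℓ : ℤ) ^ μ ∣ lam i - y i := fun i => hgen _ (by
    rw [sub_smul, ← hlam]; exact hy i P hPk)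
  have hx' : ∀ i, (ℓ : ℤ) ^ (k - μ) ∣ lam i - x i := by
    intro i
    have h0 : ℓ ^ k • (ℓ ^ μ • P) = 0 := by rw [smul_comm, hPk, smul_zero]
    have h1 : τ i (ℓ ^ μ • P) = x i • (ℓ ^ μ • P) := hx i _ hμmem h0
    rw [map_nsmul, hlam] at h1
    have h2 : (((ℓ ^ μ : ℕ) : ℤ) * (lam i - x i)) • P = 0 := by
      rw [mul_sub, sub_smul, mul_comm _ (x i), mul_smul, mul_smul, natCast_zsmul, natCast_zsmul,
        h1, sub_self]
    have h3 : (ℓ : ℤ) ^ k ∣ ((ℓ ^ μ : ℕ) : ℤ) * (lam i - x i) := (hord _).mp h2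
    rw [Int.natCast_pow, ← Nat.sub_add_cancel hμk, pow_add, mul_comm ((ℓ : ℤ) ^ (k - μ))] at h3
    exact (mul_dvd_mul_iff_left (pow_ne_zero μ hℓ0)).mp h3
  rcases Nat.eq_zero_or_pos μ with hμ0 | hμpos
  · refine Or.inr fun i => ?_
    have := hx' i
    rwa [hμ0, Nat.sub_zero] at this
  · rcases hμk.eq_or_lt with hμk' | hμlt
    · exact Or.inl fun i => by rw [← hμk']; exact hy' i
    · exfalso
      refine hi₀ ?_
      have h1 : (ℓ : ℤ) ∣ lam i₀ - y i₀ := (dvd_pow_self (ℓ : ℤ) hμpos.ne').trans (hy' i₀)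
      have h2 : (ℓ : ℤ) ∣ lam i₀ - x i₀ :=
        (dvd_pow_self (ℓ : ℤ) (Nat.sub_pos_of_lt hμlt).ne').trans (hx' i₀)
      have h3 := dvd_sub h1 h2
      rwa [sub_sub_sub_cancel_left] at h3

/-- **SS′ (PROVED here; character form of g7's SS).**  A `Γ_ℚ`-stable line in `E[N]` with character
`r`, `N ≥ 3` a prime of good reduction of the global minimal model ⇒ the reduction at `N` is ORDINARY
(`N ∤ a_N`).  This is exactly the `exfalso` branch of
`Mazur1978.modEq_zero_or_one_of_hasGoodReductionAtPrime` (Serre 1972 §1.11 Prop. 12 c): at a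
supersingular `N` inertia acts through a cyclic group of order `N² − 1`, but a stable line makes
`τ^{N−1}` unipotent).  [cite: Serre1972, §1.11 Prop. 12 c)] [cite: Mazur1978, §5 proof of Prop. 5.1] -/
theorem not_dvd_frobeniusTrace_of_isogenyCharacter (W : WeierstrassCurve ℚ) [W.IsElliptic]
    [W.IsGloballyMinimal] (N : ℕ) [Fact N.Prime] (hN3 : 3 ≤ N)
    (hgood : W.HasGoodReductionAtPrime N) {P : geomTorsion W N} (hP0 : P ≠ 0)
    {r : absoluteGaloisGroup ℚ →* (ZMod N)ˣ}
    (hr : ∀ σ : absoluteGaloisGroup ℚ, σ • P = ((r σ : (ZMod N)ˣ) : ZMod N).val • P) :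
    ¬ ((N : ℤ) ∣ W.frobeniusTrace N) := by
  intro hord
  letI : Module (ZMod N) (geomTorsion W N) := AddSubgroup.torsionBy.zmodModule
  have hN : N.Prime := Fact.out
  haveI : NeZero N := ⟨hN.ne_zero⟩
  haveI : NeZero ((N : ℕ) : ℚ) := ⟨by exact_mod_cast hN.ne_zero⟩
  set v : HeightOneSpectrum (𝓞 ℚ) := primesEquiv.symm ⟨N, hN⟩ with hvdef
  have hv : (primesEquiv v : ℕ) = N := by rw [hvdef, Equiv.apply_symm_apply]
  obtain ⟨𝔓₀, hmem₀, h𝔓₀⟩ := exists_ideal_placeOver N hv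
  haveI := h𝔓₀.1
  have hΔ := not_dvd_minimalDiscriminantInt_of_hasGoodReductionAtPrime' W N hgood
  set χ : absoluteGaloisGroup ℚ →* (ZMod N)ˣ := modNCyclotomicCharacter ℚ N with hχ
  have hval : ∀ (c : ZMod N) (S : geomTorsion W N), c.val • S = c • S := fun c S ↦ by
    rw [← Nat.cast_smul_eq_nsmul (ZMod N), ZMod.natCast_zmod_val]
  have hrP : ∀ σ : absoluteGaloisGroup ℚ, σ • P = ((r σ : (ZMod N)ˣ) : ZMod N) • P := fun σ ↦ by
    rw [hr σ, hval]
  have hN2 : N ≠ 2 := by omega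
  have hm : 0 < N ^ 2 - 1 := by
    have : 4 ≤ N ^ 2 := by nlinarith [hN.two_le]
    omega
  obtain ⟨hcyc, hcard⟩ := isCyclic_and_card_inertia_map_of_dvd_frobeniusTrace N hΔ hord hN2
    hmem₀ (fun π ζ hπ hζ ↦ exists_mem_inertia_smul_eq_mul_of_pow_eq N hm hv h𝔓₀ hπ hζ)
  set G : Subgroup (Multiplicative (AddAut (geomTorsion W N))) :=
    (𝔓₀.inertia (absoluteGaloisGroup ℚ)).map (galoisRepTorsion W N) with hG
  -- every element of the image of inertia has order dividing `N (N − 1)`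
  have hexp : ∀ x : G, x ^ (N * (N - 1)) = 1 := by
    rintro ⟨_, τ, hτ, rfl⟩
    apply Subtype.ext
    change (galoisRepTorsion W N τ) ^ (N * (N - 1)) = 1
    rw [← map_pow, galoisRepTorsion_eq_one_iff', mul_comm, pow_mul]
    set σ := τ ^ (N - 1) with hσ
    have hσI : σ ∈ 𝔓₀.inertia (absoluteGaloisGroup ℚ) := Subgroup.pow_mem _ hτ _
    have hrσ : r σ = 1 := by rw [hσ, map_pow, ZMod.units_pow_card_sub_one_eq_one]
    have hχσ : χ σ = 1 := by rw [hσ, map_pow, ZMod.units_pow_card_sub_one_eq_one]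
    have hσP : σ • P = P := by rw [hrP, hrσ, Units.val_one, one_smul]
    refine Mazur1978.pow_smul_eq_self_of_sub_mem_zmultiples W N σ hσP (fun S ↦ ?_)
    have h := Mazur1978.smul_sub_smul_mem_zmultiples_of_isogenyCharacter W N hP0 hr σ S
    rwa [modPCyclotomicCharacterZMod_eq_modNCyclotomicCharacter, ← hχ, hχσ, hrσ, inv_one,
      Units.val_one, mul_one, ZMod.val_one, one_smul] at h
  obtain ⟨x, hx⟩ := hcyc.exists_generator
  have hox : orderOf x = N ^ 2 - 1 := by rw [orderOf_eq_card_of_forall_mem_zpowers hx, hcard]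
  have hdvd : N ^ 2 - 1 ∣ N * (N - 1) := by
    rw [← hox]
    exact orderOf_dvd_of_pow_eq_one (hexp x)
  have h1 : N + 1 ∣ N * (N - 1) := by
    refine dvd_trans ⟨N - 1, ?_⟩ hdvd
    zify [show 1 ≤ N by omega, show 1 ≤ N ^ 2 by nlinarith]
    ring
  have hcop : Nat.Coprime (N + 1) N := by
    rw [Nat.coprime_comm, Nat.coprime_self_add_right]
    exact Nat.coprime_one_right N
  have h2 : N + 1 ∣ N - 1 := hcop.dvd_of_dvd_mul_left h1
  have h3 := Nat.le_of_dvd (by omega) h2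
  omega
end LOCell

end Summit.ABC.ABC.Theorems.DefiniteRTControlPrime.CyclicCharacter
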